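import Summits.SmoothPoincare4.SmoothPoincare4.Theorems.EntropyRungBakryEmeryLogSobolevGaffneyCutoff
import Summits.SmoothPoincare4.SmoothPoincare4.Theorems.EntropyRungNoncompactShrinkerGapHeatMaxPrinciple
import Literature.Geometry.Riemannian.PerelmanEntropyCutoff
import HarnessLib

/-!
# The weak maximum principle for `𝕃²` solutions of the weighted heat equation on a complete
# manifold, with first-order (Gaffney) cut-offs
# (support item `EntropyRung.BakryEmeryLogSobolev`, stmt-SmoothPoincare4-16587)

Setting: `M` modelled on `ℝⁿ` (Hausdorff, second countable, `T₃`, Borel — NOT compact), `g`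
Riemannian with its Levi-Civita connection, `V` smooth (NO further assumption), `L = Δ_g − g⁻¹(dV, d·)`,
weight `e^{-V} dV_g`; Gaffney cut-offs `η_k ∈ C_c^∞`, `0 ≤ η_k ≤ 1`, `η_k ≤ η_{k+1}`, `η_k(x) = 1`
for large `k`, `|∇η_k|² ≤ C₀/(k+1)²` (`exists_gaffney_cutoff`).

**Theorem** (`gaffney_maxPrinciple`). If `z` is smooth on `M × O` (`O ⊇ [0, T]` open),
`∂ₛz = Lz` on `[0, T] × M`, `z(0, ·) ≤ 0` and `z₊² e^{-V} ∈ L¹(M × (0,T))`, then `z ≤ 0` on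
`[0, T] × M`.

Proof: Grigor'yan's energy method (2009, §11.4 / §12.1) with the SQUARE `Φ = Ψ²` of the convex test
function of `exists_convexTest` (`Φ = 0` on `(−∞, 0]`, `Φ ≤ t₊²`, `Φ'² ≤ 2 Φ Φ''` — the inequality that
allows FIRST-ORDER cut-offs): `E_k(s) = ∫ Φ(z(s,·)) η_k² e^{-V}` has
`E_k' = −∫ η_k² Φ''(z)|∇z|² e^{-V} − 2∫ Φ'(z) η_k g⁻¹(dη_k, dz) e^{-V} ≤ 2 ∫ Φ(z) |∇η_k|² e^{-V}`
(`integral_mul_cutoffSq_mul_weightedLaplacian`, `sq_convexTest_absorb`), whence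
`0 ≤ E_k(s) ≤ 2C₀/(k+1)² ∫∫ z₊² e^{-V} → 0`; `E_k(s)` is nondecreasing in `k`, so it vanishes and
`z(s, x) ≤ 0` wherever some `η_k(x) = 1`. No bound on `Lη_k` is used (compare the shrinker toolkit's
`helper_weightedMaxPrinciple`). Everything is proved; no definitions, no named facts.

## References

* [Grigoryan2009] A. Grigor'yan, *Heat Kernel and Analysis on Manifolds* (2009), §11.4, §12.1.
* [BakryGentilLedoux2014] D. Bakry, I. Gentil, M. Ledoux (2014), §3.2, pp. 141–147.
-/

noncomputable section

set_option linter.dupNamespace false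

open scoped Manifold ContDiff ENNReal NNReal Topology
open MeasureTheory Set Filter
open Literature.Geometry.Lorentzian Literature.Geometry.Riemannian

namespace Summit.SmoothPoincare4.SmoothPoincare4.Theorems.BakryEmeryComplete

open NoncompactShrinkerGapHeat NoncompactShrinkerGapHeat.CutoffToolkit

/-! ### The pointwise absorption inequality behind `Φ = Ψ²` -/

/-- **First-order absorption for the squared test function.** For `ψ, ψ' ≥ 0`, `ψ'' ≥ 0`
(values of `Ψ, Ψ', Ψ''`), `Q = |∇z|² ≥ 0`, `G = |∇η|² ≥ 0` and `I = g⁻¹(dη, dz)` with `I² ≤ G Q`: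
`−(η² (2ψ'² + 2ψψ'') Q) − 2 (2ψψ' η I) ≤ 2 ψ² G`, i.e. `−Φ''η²|∇z|² − 2Φ'η g⁻¹(dη,dz) ≤ 2Φ|∇η|²`
for `Φ = Ψ²` (`(4ψψ'ηI)² ≤ (2ψ'²η²Q + 2ψ²G)²` since the difference is `4(ψ'²η²Q − ψ²G)² + 16ψ²ψ'²η²(GQ − I²)`).
[folklore] -/
theorem sq_convexTest_absorb {ψ ψ' ψ'' Q G I η : ℝ} (h0 : 0 ≤ ψ) (_h1 : 0 ≤ ψ') (h2 : 0 ≤ ψ'')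
    (hQ : 0 ≤ Q) (hG : 0 ≤ G) (hI : I ^ 2 ≤ G * Q) :
    -(η ^ 2 * (2 * ψ' ^ 2 + 2 * ψ * ψ'') * Q) - 2 * (2 * ψ * ψ' * η * I) ≤ 2 * ψ ^ 2 * G := by
  set a : ℝ := ψ' ^ 2 * η ^ 2 * Q with ha
  set b : ℝ := ψ ^ 2 * G with hb
  have ha0 : 0 ≤ a := mul_nonneg (mul_nonneg (sq_nonneg _) (sq_nonneg _)) hQ
  have hb0 : 0 ≤ b := mul_nonneg (sq_nonneg _) hG
  have hsq : (4 * ψ * ψ' * η * I) ^ 2 ≤ (2 * a + 2 * b) ^ 2 := by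
    have e1 : (4 * ψ * ψ' * η * I) ^ 2 = 16 * (ψ ^ 2 * ψ' ^ 2 * η ^ 2) * I ^ 2 := by ring
    have e2 : (2 * a + 2 * b) ^ 2 = 4 * (a - b) ^ 2 + 16 * (ψ ^ 2 * ψ' ^ 2 * η ^ 2) * (G * Q) := by
      simp only [ha, hb]; ring
    rw [e1, e2]
    have h3 : 0 ≤ 16 * (ψ ^ 2 * ψ' ^ 2 * η ^ 2) := by positivity
    nlinarith [mul_le_mul_of_nonneg_left hI h3, sq_nonneg (a - b)]
  have habs := abs_le_of_sq_le_sq' hsq (by linarith)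
  have hcross : -(4 * ψ * ψ' * η * I) ≤ 2 * a + 2 * b := by linarith [habs.1]
  have hextra : 0 ≤ η ^ 2 * (2 * ψ * ψ'') * Q := by positivity
  have e3 : -(η ^ 2 * (2 * ψ' ^ 2 + 2 * ψ * ψ'') * Q) - 2 * (2 * ψ * ψ' * η * I) =
      -(2 * a) - η ^ 2 * (2 * ψ * ψ'') * Q + -(4 * ψ * ψ' * η * I) := by simp only [ha]; ring
  rw [e3]
  linarith

section MaxPrinciple

variable {n : ℕ} {M : Type*} [TopologicalSpace M] [T2Space M] [SecondCountableTopology M]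
  [ChartedSpace (EuclideanSpace ℝ (Fin n)) M] [IsManifold (𝓡 n) ∞ M] [T3Space M]
  [MeasurableSpace M] [BorelSpace M]
  {g : PseudoRiemannianMetric (𝓡 n) ∞ (EuclideanSpace ℝ (Fin n)) (TangentSpace (𝓡 n) : M → Type _)}
  [g.HasLeviCivita]

/-- **The dissipation inequality for `Φ = Ψ²` with a first-order cut-off.** For `z, V` smooth,
`η ∈ C_c^∞`, and `Ψ` smooth with `Ψ, Ψ', Ψ'' ≥ 0`:
`∫ (2Ψ(z)Ψ'(z)) η² (Lz) e^{-V} ≤ 2 ∫ Ψ(z)² |∇η|² e^{-V}` — the weighted Green identity against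
`Φ'(z) η²` (`integral_mul_cutoffSq_mul_weightedLaplacian`) and `sq_convexTest_absorb` pointwise.
[cite: Grigoryan2009, §12.1 (energy estimate with cut-off)] -/
theorem integral_sqTest_dissipation_le (hg : g.IsRiemannian) {z η V : M → ℝ}
    (hz : ContMDiff (𝓡 n) 𝓘(ℝ, ℝ) ∞ z) (hη : ContMDiff (𝓡 n) 𝓘(ℝ, ℝ) ∞ η)
    (hηc : HasCompactSupport η) (hV : ContMDiff (𝓡 n) 𝓘(ℝ, ℝ) ∞ V)
    {Ψ : ℝ → ℝ} (hΨ : ContDiff ℝ ∞ Ψ) (hΨ0 : ∀ t, 0 ≤ Ψ t) (hΨ1 : ∀ t, 0 ≤ deriv Ψ t)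
    (hΨ2 : ∀ t, 0 ≤ deriv (deriv Ψ) t) :
    ∫ x, (2 * Ψ (z x) * deriv Ψ (z x)) * η x ^ 2 * (g.dalembertian z x
        - g.innerDual x (mvfderiv (𝓡 n) V x).toLinearMap (mvfderiv (𝓡 n) z x).toLinearMap) *
        Real.exp (-V x) ∂g.riemVolume ≤
      2 * ∫ x, Ψ (z x) ^ 2 * (g.gradSq η x * Real.exp (-V x)) ∂g.riemVolume := by
  haveI := CarrilloNi2009_shrinkerLSI.isFiniteMeasureOnCompacts_riemVolume hg
  have h1le : (1 : ℕ∞ω) ≤ (∞ : ℕ∞ω) := WithTop.coe_le_coe.mpr le_top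
  -- the one-variable functions `φ₁ = Φ' = 2ΨΨ'`, `φ₂ = Φ'' = 2Ψ'² + 2ΨΨ''`
  have hΨ' : ContDiff ℝ ∞ (deriv Ψ) := (contDiff_infty_iff_deriv.1 hΨ).2
  have hΨ'' : ContDiff ℝ ∞ (deriv (deriv Ψ)) := (contDiff_infty_iff_deriv.1 hΨ').2
  have hΨd : ∀ t, HasDerivAt Ψ (deriv Ψ t) t := fun t ↦ (hΨ.differentiable (by simp) t).hasDerivAt
  have hΨ'd : ∀ t, HasDerivAt (deriv Ψ) (deriv (deriv Ψ) t) t := fun t ↦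
    (hΨ'.differentiable (by simp) t).hasDerivAt
  set φ₁ : ℝ → ℝ := fun t ↦ 2 * Ψ t * deriv Ψ t with hφ₁
  set φ₂ : ℝ → ℝ := fun t ↦ 2 * deriv Ψ t ^ 2 + 2 * Ψ t * deriv (deriv Ψ) t with hφ₂
  have hφ₁s : ContDiff ℝ ∞ φ₁ := (contDiff_const.mul hΨ).mul hΨ'
  have hφ₁d : ∀ t, HasDerivAt φ₁ (φ₂ t) t := fun t ↦ by
    have h := (((hΨd t).const_mul 2).mul (hΨ'd t))
    refine h.congr_deriv ?_
    simp only [hφ₂]; ring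
  -- the Green identity against `φ₁(z) η²`
  have ha : ContMDiff (𝓡 n) 𝓘(ℝ, ℝ) ∞ (fun y ↦ φ₁ (z y)) := hφ₁s.comp_contMDiff hz
  have hid := integral_mul_cutoffSq_mul_weightedLaplacian hg (a := fun y ↦ φ₁ (z y)) ha hz hη hηc hV
  -- chain rule: `g⁻¹(d(φ₁∘z), dz) = φ₂(z) |∇z|²`
  have hzd : ∀ x, MDifferentiableAt (𝓡 n) 𝓘(ℝ, ℝ) z x := fun x ↦ hz.mdifferentiableAt (by simp)
  have hch : ∀ x, (mvfderiv (𝓡 n) (fun y ↦ φ₁ (z y)) x).toLinearMap =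
      φ₂ (z x) • (mvfderiv (𝓡 n) z x).toLinearMap := fun x ↦ by
    ext v
    exact mvfderiv_real_comp_apply (I := 𝓡 n) (hφ₁d (z x)) (hzd x) v
  have hpt1 : ∀ x, g.innerDual x (mvfderiv (𝓡 n) (fun y ↦ φ₁ (z y)) x).toLinearMap
      (mvfderiv (𝓡 n) z x).toLinearMap = φ₂ (z x) * g.gradSq z x := fun x ↦ by
    rw [hch x, g.innerDual_smul_left]; rfl
  -- the pointwise absorption
  have hpt : ∀ x, -(η x ^ 2 * g.innerDual x (mvfderiv (𝓡 n) (fun y ↦ φ₁ (z y)) x).toLinearMap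
        (mvfderiv (𝓡 n) z x).toLinearMap * Real.exp (-V x))
      - 2 * ((fun y ↦ φ₁ (z y)) x * η x * g.innerDual x (mvfderiv (𝓡 n) η x).toLinearMap
        (mvfderiv (𝓡 n) z x).toLinearMap * Real.exp (-V x)) ≤
      2 * (Ψ (z x) ^ 2 * (g.gradSq η x * Real.exp (-V x))) := by
    intro x
    rw [hpt1 x]
    have hI := abs_innerDual_le_sqrt_gradSq_mul hg η z x
    set I := g.innerDual x (mvfderiv (𝓡 n) η x).toLinearMap (mvfderiv (𝓡 n) z x).toLinearMap
    have hQ : 0 ≤ g.gradSq z x := g.gradSq_nonneg hg z x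
    have hG : 0 ≤ g.gradSq η x := g.gradSq_nonneg hg η x
    have hI2 : I ^ 2 ≤ g.gradSq η x * g.gradSq z x := by
      have h := pow_le_pow_left₀ (abs_nonneg I) hI 2
      rwa [sq_abs, mul_pow, Real.sq_sqrt hG, Real.sq_sqrt hQ] at h
    have habs := sq_convexTest_absorb (η := η x) (hΨ0 (z x)) (hΨ1 (z x)) (hΨ2 (z x)) hQ hG hI2
    have hex : 0 ≤ Real.exp (-V x) := (Real.exp_pos _).le
    have key := mul_le_mul_of_nonneg_right habs hex
    simp only [hφ₁, hφ₂] at key ⊢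
    nlinarith [key]
  -- integrability (everything is continuous with compact support)
  have hec : Continuous fun x ↦ Real.exp (-V x) := Real.continuous_exp.comp hV.continuous.neg
  have hgradη : Continuous (g.gradSq η) := (contMDiff_gradSq g hη).continuous
  have hgradηs : HasCompactSupport (g.gradSq η) :=
    HasCompactSupport.intro hηc fun x hx ↦ gradSq_eq_zero_of_notMem_tsupport hx
  have hη2c : HasCompactSupport (fun x ↦ η x ^ 2) := by
    rw [show (fun x ↦ η x ^ 2) = fun x ↦ η x * η x from funext fun x ↦ sq (η x)]
    exact hηc.mul_right
  have hI1c : Continuous fun x ↦ g.innerDual x (mvfderiv (𝓡 n) (fun y ↦ φ₁ (z y)) x).toLinearMap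
      (mvfderiv (𝓡 n) z x).toLinearMap := continuous_innerDual_mvfderiv g (ha.of_le h1le) (hz.of_le h1le)
  have hI2c : Continuous fun x ↦ g.innerDual x (mvfderiv (𝓡 n) η x).toLinearMap
      (mvfderiv (𝓡 n) z x).toLinearMap := continuous_innerDual_mvfderiv g (hη.of_le h1le) (hz.of_le h1le)
  have iA : Integrable (fun x ↦ η x ^ 2 * g.innerDual x
      (mvfderiv (𝓡 n) (fun y ↦ φ₁ (z y)) x).toLinearMap (mvfderiv (𝓡 n) z x).toLinearMap *
      Real.exp (-V x)) g.riemVolume :=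
    integrable_of_continuous_of_hasCompactSupport' hg (((hη.continuous.pow 2).mul hI1c).mul hec)
      (hη2c.mul_right.mul_right)
  have iB : Integrable (fun x ↦ (fun y ↦ φ₁ (z y)) x * η x * g.innerDual x
      (mvfderiv (𝓡 n) η x).toLinearMap (mvfderiv (𝓡 n) z x).toLinearMap * Real.exp (-V x)) g.riemVolume :=
    integrable_of_continuous_of_hasCompactSupport' hg (((ha.continuous.mul hη.continuous).mul hI2c).mul hec)
      (((hηc.mul_left).mul_right).mul_right)
  have iAn : Integrable (fun x ↦ -(η x ^ 2 * g.innerDual x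
        (mvfderiv (𝓡 n) (fun y ↦ φ₁ (z y)) x).toLinearMap (mvfderiv (𝓡 n) z x).toLinearMap *
          Real.exp (-V x))) g.riemVolume := iA.neg
  have iB2 : Integrable (fun x ↦ 2 * ((fun y ↦ φ₁ (z y)) x * η x * g.innerDual x
      (mvfderiv (𝓡 n) η x).toLinearMap (mvfderiv (𝓡 n) z x).toLinearMap * Real.exp (-V x))) g.riemVolume :=
    iB.const_mul 2
  have iL : Integrable (fun x ↦ -(η x ^ 2 * g.innerDual x
        (mvfderiv (𝓡 n) (fun y ↦ φ₁ (z y)) x).toLinearMap (mvfderiv (𝓡 n) z x).toLinearMap *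
          Real.exp (-V x))
      - 2 * ((fun y ↦ φ₁ (z y)) x * η x * g.innerDual x (mvfderiv (𝓡 n) η x).toLinearMap
        (mvfderiv (𝓡 n) z x).toLinearMap * Real.exp (-V x))) g.riemVolume :=
    iAn.sub iB2
  have iR : Integrable (fun x ↦ 2 * (Ψ (z x) ^ 2 * (g.gradSq η x * Real.exp (-V x)))) g.riemVolume := by
    refine (integrable_of_continuous_of_hasCompactSupport' hg
      (((hΨ.continuous.comp hz.continuous).pow 2).mul (hgradη.mul hec)) ?_).const_mul 2
    exact (hgradηs.mul_right).mul_left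
  have hmono := integral_mono iL iR hpt
  rw [integral_sub iAn iB2, integral_neg, integral_const_mul, integral_const_mul] at hmono
  rw [hid]
  exact hmono

/-- **Weak maximum principle for `𝕃²` solutions of the weighted heat equation on a complete
weighted manifold, with Gaffney cut-offs.** `V` smooth (no other assumption); `η_k ∈ C_c^∞`,
`0 ≤ η_k ≤ 1`, `η_k ≤ η_{k+1}`, `η_k(x) = 1` for large `k`, `|∇η_k|² ≤ C₀/(k+1)²`. If `z` is smooth on
`M × O` (`O ⊇ [0,T]` open) with `∂ₛz = Lz` on `[0, T]`, `z(0, ·) ≤ 0` and `z₊² e^{-V}` integrable on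
the strip `M × (0, T)`, then `z ≤ 0` on `[0, T] × M`. Energy method with `Φ = Ψ²`
(`exists_convexTest`, `integral_sqTest_dissipation_le`): `0 ≤ E_k(s) = ∫ Φ(z(s))η_k²e^{-V}
≤ 2C₀/(k+1)² ∫∫ z₊² e^{-V} → 0`, `E_k` nondecreasing in `k`. This is the uniqueness / comparison
class `𝕃²(e^{-V}dV_g ⊗ dt)` of the minimal heat semigroup on a complete weighted manifold.
[cite: Grigoryan2009, §11.4 and §12.1] [cite: BakryGentilLedoux2014, §3.2 (pp. 141–147)] -/
theorem gaffney_maxPrinciple (hg : g.IsRiemannian) {V : M → ℝ} (hV : ContMDiff (𝓡 n) 𝓘(ℝ, ℝ) ∞ V)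
    {η : ℕ → M → ℝ} {C₀ : ℝ} (hηs : ∀ k, ContMDiff (𝓡 n) 𝓘(ℝ, ℝ) ∞ (η k))
    (hηc : ∀ k, HasCompactSupport (η k)) (hη01 : ∀ k x, 0 ≤ η k x ∧ η k x ≤ 1)
    (hηmono : ∀ k x, η k x ≤ η (k + 1) x) (hη1 : ∀ x, ∀ᶠ k in atTop, η k x = 1)
    (hηgrad : ∀ k x, g.gradSq (η k) x ≤ C₀ / ((k : ℝ) + 1) ^ 2)
    {T : ℝ} {O : Set ℝ} {z : ℝ → M → ℝ} (hO : IsOpen O) (hTO : Icc 0 T ⊆ O)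
    (hz : ContMDiffOn ((𝓡 n).prod 𝓘(ℝ, ℝ)) 𝓘(ℝ, ℝ) ∞ (fun p : M × ℝ ↦ z p.2 p.1) (univ ×ˢ O))
    (heq : ∀ s ∈ Icc 0 T, ∀ x, deriv (fun r ↦ z r x) s = g.dalembertian (z s) x
      - g.innerDual x (mvfderiv (𝓡 n) V x).toLinearMap (mvfderiv (𝓡 n) (z s) x).toLinearMap)
    (hz0 : ∀ x, z 0 x ≤ 0)
    (hint : Integrable (fun p : M × ℝ ↦ max (z p.2 p.1) 0 ^ 2 * Real.exp (-V p.1))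
      ((g.riemVolume.prod (volume : Measure ℝ)).restrict (univ ×ˢ Ioo 0 T))) :
    ∀ s ∈ Icc 0 T, ∀ x, z s x ≤ 0 := by
  intro s₀ hs₀ x₀
  -- topology and measure
  haveI : LocallyCompactSpace M := Manifold.locallyCompact_of_finiteDimensional (M := M) (𝓡 n)
  haveI : IsFiniteMeasureOnCompacts g.riemVolume := CarrilloNi2009_shrinkerLSI.isFiniteMeasureOnCompacts_riemVolume hg
  haveI : IsLocallyFiniteMeasure g.riemVolume := isLocallyFiniteMeasure_of_isFiniteMeasureOnCompacts
  haveI : g.riemVolume.IsOpenPosMeasure := isOpenPosMeasure_riemVolume hg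
  haveI := sigmaFinite_riemVolume hg
  set μ : Measure M := g.riemVolume with hμ
  have hεpos : ∀ k : ℕ, (0 : ℝ) < ((k : ℝ) + 1) ^ 2 := fun k ↦ by positivity
  -- the test function `Φ = Ψ²`
  obtain ⟨Ψ, hΨs, hΨneg, hΨ', hΨ'', hΨbd, hΨzero⟩ := exists_convexTest
  have hΨd : ∀ t, HasDerivAt Ψ (deriv Ψ t) t := fun t ↦ (hΨs.differentiable (by simp) t).hasDerivAt
  have hΨc : Continuous Ψ := hΨs.continuous
  have hΨ'c : Continuous (deriv Ψ) := hΨs.continuous_deriv (by simp)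
  have hΦbd : ∀ t, Ψ t ^ 2 ≤ max t 0 ^ 2 := fun t ↦ pow_le_pow_left₀ (hΨbd t).1 (hΨbd t).2 2
  -- regularity of `z`: slices, joint continuity, time derivative
  have hexpc : Continuous fun x ↦ Real.exp (-V x) := Real.continuous_exp.comp hV.continuous.neg
  have hzs : ∀ s ∈ O, ContMDiff (𝓡 n) 𝓘(ℝ, ℝ) ∞ (z s) := fun s hs ↦ contMDiff_slice_of_contMDiffOn hz hs
  have hzc : ContinuousOn (fun p : M × ℝ ↦ z p.2 p.1) (univ ×ˢ O) := hz.continuousOn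
  have hz'c : ContinuousOn (fun p : M × ℝ ↦ deriv (fun r ↦ z r p.1) p.2) (univ ×ˢ O) := continuousOn_deriv_time hO hz
  -- the integrands `F = Ψ(z)²`, `F' = 2Ψ(z)Ψ'(z) ∂ₛz`
  set F : ℝ → M → ℝ := fun s x ↦ Ψ (z s x) ^ 2 with hF
  set F' : ℝ → M → ℝ := fun s x ↦ 2 * Ψ (z s x) * deriv Ψ (z s x) * deriv (fun r ↦ z r x) s with hF'
  have hFc : ContinuousOn (fun p : M × ℝ ↦ F p.2 p.1) (univ ×ˢ O) := (hΨc.comp_continuousOn hzc).pow 2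
  have hF'c : ContinuousOn (fun p : M × ℝ ↦ F' p.2 p.1) (univ ×ˢ O) :=
    ((continuousOn_const.mul (hΨc.comp_continuousOn hzc)).mul (hΨ'c.comp_continuousOn hzc)).mul hz'c
  have hFd : ∀ s ∈ O, ∀ x, HasDerivAt (F · x) (F' s x) s := fun s hs x ↦ by
    have h1 : HasDerivAt (fun r ↦ Ψ (z r x)) (deriv Ψ (z s x) * deriv (fun r ↦ z r x) s) s :=
      (hΨd (z s x)).comp s (hasDerivAt_time hO hz x hs)
    have h := h1.mul h1
    have e1 : (F · x) = fun r ↦ Ψ (z r x) * Ψ (z r x) := funext fun r ↦ by simp only [hF, sq]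
    rw [e1]
    refine h.congr_deriv ?_
    simp only [hF']
    ring
  -- the weights `h k = η_k² e^{-V}`, energies `E k`, derivatives `E' k`, error terms `Y k`
  have hη2c : ∀ k, HasCompactSupport (fun x ↦ η k x ^ 2) := fun k ↦ by
    rw [show (fun x ↦ η k x ^ 2) = fun x ↦ η k x * η k x from funext fun x ↦ sq (η k x)]
    exact (hηc k).mul_right
  set h : ℕ → M → ℝ := fun k x ↦ η k x ^ 2 * Real.exp (-V x) with hh
  have hhc : ∀ k, Continuous (h k) := fun k ↦ ((hηs k).continuous.pow 2).mul hexpc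
  have hhs : ∀ k, HasCompactSupport (h k) := fun k ↦ (hη2c k).mul_right
  have hh0 : ∀ k x, 0 ≤ h k x := fun k x ↦ mul_nonneg (sq_nonneg _) (Real.exp_pos _).le
  have hgradηc : ∀ k, Continuous (g.gradSq (η k)) := fun k ↦ (contMDiff_gradSq g (hηs k)).continuous
  have hgradηs : ∀ k, HasCompactSupport (g.gradSq (η k)) := fun k ↦
    HasCompactSupport.intro (hηc k) fun x hx ↦ gradSq_eq_zero_of_notMem_tsupport hx
  set wY : ℕ → M → ℝ := fun k x ↦ g.gradSq (η k) x * Real.exp (-V x) with hwY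
  have hwYc : ∀ k, Continuous (wY k) := fun k ↦ (hgradηc k).mul hexpc
  have hwYs : ∀ k, HasCompactSupport (wY k) := fun k ↦ (hgradηs k).mul_right
  set E : ℕ → ℝ → ℝ := fun k s ↦ ∫ x, F s x * h k x ∂μ with hE
  set E' : ℕ → ℝ → ℝ := fun k s ↦ ∫ x, F' s x * h k x ∂μ with hE'
  set Y : ℕ → ℝ → ℝ := fun k s ↦ ∫ x, F s x * wY k x ∂μ with hYdef
  have hEd : ∀ k, ∀ s ∈ O, HasDerivAt (E k) (E' k s) s := fun k s hs ↦
    hasDerivAt_integral_mul_of_hasCompactSupport μ (hhc k) (hhs k) hO hFc hF'c hFd hs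
  have hE'c : ∀ k, ContinuousOn (E' k) O := fun k ↦ continuousOn_integral_mul_of_hasCompactSupport μ (hhc k) (hhs k) hF'c
  have hYc : ∀ k, ContinuousOn (Y k) O := fun k ↦ continuousOn_integral_mul_of_hasCompactSupport μ (hwYc k) (hwYs k) hFc
  -- the dissipation bound `E' ≤ 2 Y` on `[0, T]`
  have hE'le : ∀ k, ∀ s ∈ Icc 0 T, E' k s ≤ 2 * Y k s := by
    intro k s hs
    have hsO := hTO hs
    have hws := hzs s hsO
    have step := integral_sqTest_dissipation_le hg hws (hηs k) (hηc k) hV hΨs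
      (fun t ↦ (hΨbd t).1) (fun t ↦ (hΨ' t).1) hΨ''
    have e1 : E' k s = ∫ x, (2 * Ψ (z s x) * deriv Ψ (z s x)) * η k x ^ 2 * (g.dalembertian (z s) x
        - g.innerDual x (mvfderiv (𝓡 n) V x).toLinearMap (mvfderiv (𝓡 n) (z s) x).toLinearMap) *
        Real.exp (-V x) ∂μ := by
      refine integral_congr_ae (Eventually.of_forall fun x ↦ ?_)
      simp only [hF', hh, heq s hs x]
      ring
    have e2 : 2 * Y k s = 2 * ∫ x, Ψ (z s x) ^ 2 * (g.gradSq (η k) x * Real.exp (-V x)) ∂μ := by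
      simp only [hYdef, hF, hwY]
    rw [e1, e2]
    exact step
  -- integrating in time: `E k s₀ ≤ 2 ∫₀^{s₀} Y k ≤ 2 C₀/(k+1)² P`
  set ν : Measure (M × ℝ) := (μ.prod (volume : Measure ℝ)).restrict (univ ×ˢ Ioo 0 T) with hν
  set P : ℝ := ∫ p, max (z p.2 p.1) 0 ^ 2 * Real.exp (-V p.1) ∂ν with hP
  have hEbound : ∀ k, E k s₀ ≤ 2 * (C₀ / ((k : ℝ) + 1) ^ 2 * P) := by
    intro k
    rcases eq_or_lt_of_le hs₀.1 with h0 | hpos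
    · -- `s₀ = 0`: `E k 0 = 0`
      have hE0 : E k s₀ = 0 := by
        rw [← h0]
        refine integral_eq_zero_of_ae (ae_of_all _ fun x ↦ ?_)
        simp [hF, hΨneg _ (hz0 x)]
      rw [hE0]
      have hC : 0 ≤ C₀ / ((k : ℝ) + 1) ^ 2 := by
        have h1 := hηgrad k x₀
        exact (g.gradSq_nonneg hg _ _).trans h1
      positivity
    · have hIcc : Icc 0 s₀ ⊆ O := fun s hs ↦ hTO ⟨hs.1, hs.2.trans hs₀.2⟩
      have hderiv : ∀ s ∈ uIcc 0 s₀, HasDerivAt (E k) (E' k s) s := by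
        intro s hs
        rw [uIcc_of_le hs₀.1] at hs
        exact hEd k s (hIcc hs)
      have hE'i : IntervalIntegrable (E' k) volume 0 s₀ :=
        ((hE'c k).mono (by rw [uIcc_of_le hs₀.1]; exact hIcc)).intervalIntegrable
      have hYi : IntervalIntegrable (Y k) volume 0 s₀ :=
        ((hYc k).mono (by rw [uIcc_of_le hs₀.1]; exact hIcc)).intervalIntegrable
      have hYi2 : IntervalIntegrable (fun s ↦ 2 * Y k s) volume 0 s₀ := hYi.const_mul 2
      have hFTC := intervalIntegral.integral_eq_sub_of_hasDerivAt hderiv hE'i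
      have hE0 : E k 0 = 0 := by
        refine integral_eq_zero_of_ae (ae_of_all _ fun x ↦ ?_)
        simp [hF, hΨneg _ (hz0 x)]
      -- Fubini on the strip `M × (0, s₀)` for `Y k`, then compare with `P`
      set ν' : Measure (M × ℝ) := (μ.prod (volume : Measure ℝ)).restrict (univ ×ˢ Ioo 0 s₀) with hν'
      have hYF : ∫ p, F p.2 p.1 * wY k p.1 ∂ν' = ∫ s in (0 : ℝ)..s₀, Y k s :=
        integral_strip_eq_intervalIntegral μ hs₀.1
          (integrable_strip_mul_of_hasCompactSupport μ (hFc.mono (prod_mono le_rfl hIcc)) (hwYc k)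
            (hwYs k))
      have hsub : (univ : Set M) ×ˢ Ioo (0 : ℝ) s₀ ⊆ (univ : Set M) ×ˢ Ioo 0 T :=
        prod_mono le_rfl (Ioo_subset_Ioo le_rfl hs₀.2)
      have hintP' : Integrable (fun p : M × ℝ ↦ max (z p.2 p.1) 0 ^ 2 * Real.exp (-V p.1)) ν' :=
        hint.mono_measure (Measure.restrict_mono hsub le_rfl)
      have hmeasF : AEStronglyMeasurable (fun p : M × ℝ ↦ F p.2 p.1 * wY k p.1) ν' :=
        aestronglyMeasurable_strip μ ((hFc.mono (prod_mono le_rfl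
          (Ioo_subset_Icc_self.trans hIcc))).mul ((hwYc k).comp continuous_fst).continuousOn)
      have hbd : ∀ p : M × ℝ, ‖F p.2 p.1 * wY k p.1‖ ≤
          C₀ / ((k : ℝ) + 1) ^ 2 * (max (z p.2 p.1) 0 ^ 2 * Real.exp (-V p.1)) := by
        intro p
        rw [Real.norm_eq_abs, abs_of_nonneg (mul_nonneg (sq_nonneg _)
          (mul_nonneg (g.gradSq_nonneg hg _ _) (Real.exp_pos _).le))]
        change Ψ (z p.2 p.1) ^ 2 * (g.gradSq (η k) p.1 * Real.exp (-V p.1)) ≤ _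
        have h1 := hΦbd (z p.2 p.1)
        have h2 := hηgrad k p.1
        have hex := (Real.exp_pos (-V p.1)).le
        have h3 : 0 ≤ max (z p.2 p.1) 0 ^ 2 := sq_nonneg _
        calc Ψ (z p.2 p.1) ^ 2 * (g.gradSq (η k) p.1 * Real.exp (-V p.1))
            ≤ max (z p.2 p.1) 0 ^ 2 * (C₀ / ((k : ℝ) + 1) ^ 2 * Real.exp (-V p.1)) :=
              mul_le_mul h1 (mul_le_mul_of_nonneg_right h2 hex) (mul_nonneg (g.gradSq_nonneg hg _ _) hex) h3
          _ = C₀ / ((k : ℝ) + 1) ^ 2 * (max (z p.2 p.1) 0 ^ 2 * Real.exp (-V p.1)) := by ring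
      have hstrip_le : ∫ p, F p.2 p.1 * wY k p.1 ∂ν' ≤ C₀ / ((k : ℝ) + 1) ^ 2 * P := by
        calc ∫ p, F p.2 p.1 * wY k p.1 ∂ν' ≤ ∫ p, ‖F p.2 p.1 * wY k p.1‖ ∂ν' :=
              (Real.le_norm_self _).trans (norm_integral_le_integral_norm _)
          _ ≤ ∫ p, C₀ / ((k : ℝ) + 1) ^ 2 * (max (z p.2 p.1) 0 ^ 2 * Real.exp (-V p.1)) ∂ν' :=
              integral_mono_of_nonneg (Eventually.of_forall fun p ↦ norm_nonneg _) (hintP'.const_mul _)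
                (Eventually.of_forall hbd)
          _ = C₀ / ((k : ℝ) + 1) ^ 2 * ∫ p, max (z p.2 p.1) 0 ^ 2 * Real.exp (-V p.1) ∂ν' :=
              integral_const_mul _ _
          _ ≤ C₀ / ((k : ℝ) + 1) ^ 2 * P := by
              refine mul_le_mul_of_nonneg_left ?_ ((g.gradSq_nonneg hg _ x₀).trans (hηgrad k x₀))
              exact integral_mono_measure (Measure.restrict_mono hsub le_rfl)
                (Eventually.of_forall fun p ↦ mul_nonneg (sq_nonneg _) (Real.exp_pos _).le) hint
      calc E k s₀ = ∫ s in (0 : ℝ)..s₀, E' k s := by rw [hFTC, hE0, sub_zero]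
        _ ≤ ∫ s in (0 : ℝ)..s₀, 2 * Y k s :=
            intervalIntegral.integral_mono_on hs₀.1 hE'i hYi2 fun s hs ↦ hE'le k s ⟨hs.1, hs.2.trans hs₀.2⟩
        _ = 2 * ∫ s in (0 : ℝ)..s₀, Y k s := intervalIntegral.integral_const_mul _ _
        _ = 2 * ∫ p, F p.2 p.1 * wY k p.1 ∂ν' := by rw [hYF]
        _ ≤ 2 * (C₀ / ((k : ℝ) + 1) ^ 2 * P) := by linarith [hstrip_le]
  -- the bound tends to `0`
  have hlim : Tendsto (fun k : ℕ ↦ 2 * (C₀ / ((k : ℝ) + 1) ^ 2 * P)) atTop (𝓝 0) := by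
    have h1 : Tendsto (fun k : ℕ ↦ ((k : ℝ) + 1) ^ 2) atTop atTop :=
      (tendsto_pow_atTop two_ne_zero).comp
        (tendsto_atTop_add_const_right _ 1 (tendsto_natCast_atTop_atTop (R := ℝ)))
    have h2 : Tendsto (fun k : ℕ ↦ C₀ / ((k : ℝ) + 1) ^ 2) atTop (𝓝 0) :=
      tendsto_const_nhds.div_atTop h1
    simpa using (h2.mul_const P).const_mul 2
  -- every energy vanishes at `s₀`
  have hs₀O := hTO hs₀
  have hFsc : Continuous (F s₀) := (hΨc.comp (hzs s₀ hs₀O).continuous).pow 2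
  have hEi : ∀ k, Integrable (fun x ↦ F s₀ x * h k x) μ := fun k ↦
    integrable_of_continuous_of_hasCompactSupport' hg (hFsc.mul (hhc k)) ((hhs k).mul_left)
  have hEmono : ∀ k j, k ≤ j → E k s₀ ≤ E j s₀ := by
    intro k j hkj
    refine integral_mono (hEi k) (hEi j) fun x ↦ ?_
    have hηle : η k x ≤ η j x := (monotone_nat_of_le_succ fun m ↦ hηmono m x) hkj
    have hη2le : η k x ^ 2 ≤ η j x ^ 2 := pow_le_pow_left₀ (hη01 k x).1 hηle 2
    exact mul_le_mul_of_nonneg_left (mul_le_mul_of_nonneg_right hη2le (Real.exp_pos _).le)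
      (sq_nonneg _)
  have hEzero : ∀ k, E k s₀ = 0 := by
    intro k
    refine le_antisymm ?_ (integral_nonneg fun x ↦ mul_nonneg (sq_nonneg _) (hh0 k x))
    exact ge_of_tendsto hlim (eventually_atTop.2 ⟨k, fun j hj ↦ (hEmono k j hj).trans (hEbound j)⟩)
  -- conclusion at `x₀`
  obtain ⟨k, hk1⟩ := (hη1 x₀).exists
  have hcont : Continuous fun x ↦ F s₀ x * h k x := hFsc.mul (hhc k)
  have hnn : 0 ≤ fun x ↦ F s₀ x * h k x := fun x ↦ mul_nonneg (sq_nonneg _) (hh0 k x)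
  have hae := (integral_eq_zero_iff_of_nonneg hnn (hEi k)).1 (hEzero k)
  have heq0 := (hcont.ae_eq_iff_eq μ continuous_const).1 hae
  have hx : F s₀ x₀ * h k x₀ = 0 := congr_fun heq0 x₀
  have hpos : 0 < h k x₀ := by simp only [hh, hk1, one_pow, one_mul]; exact Real.exp_pos _
  have hΦ0 : Ψ (z s₀ x₀) ^ 2 = 0 := by
    rcases mul_eq_zero.1 hx with h0 | h0
    · exact h0
    · exact absurd h0 hpos.ne'
  exact hΨzero _ (pow_eq_zero_iff two_ne_zero |>.1 hΦ0)

end MaxPrinciple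

end Summit.SmoothPoincare4.SmoothPoincare4.Theorems.BakryEmeryComplete

end
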